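import Literature.MathematicalPhysics.QuantumFieldTheory.BalabanImbrieJaffe1984to88.BIJ88Eq5127ProductMeasure

/-!
# `BalabanImbrieJaffe1984to88.BIJ88Eq5127GaugeSector` — T. Bałaban, J. Imbrie, A. Jaffe, *Effective action and cluster properties of the
abelian Higgs model*, Commun. Math. Phys. **114** (1988) 257–315 [BalabanImbrieJaffe1988], Sect. 5.12 *Conditional Integration*: **(5.12.3)** p. 301
[PDF 45], **(5.12.7)** p. 302 [PDF 46] and **(5.12.8)** p. 303 [PDF 47] — **THE GAUGE SECTOR OF THE CONDITIONING BY NAME: with the PRINTED gauge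
weight `exp[−½⟨Λ^{c*c}_{10}A, ∂*σ_{k,loc}∂(Λ^{c*c}_{10} + 2Λ^{c*}_{10})A⟩]` read on the torus configuration through the Lie-algebra coordinates of the
translated bond variables, (5.9.6) ⇒ (5.12.8) holds with the exterior factor `𝒩 = c·Z_{Λ^{c*c}_{10}}·e^{fourthForm+fifthForm}·Z_{Λ₁₀}(u_{k+1})·e^{thirdForm}`
(p02's `BIJ88ExteriorForms5121.eq5123_calc` BY NAME) and the interior law = the glued image of p02's ℝ-Gaussians `BIJ88Measure5127.muA ⊗ muφ`
((5.12.7) BY NAME), MODULO ONE DISPLAYED MEASURE-LEVEL HYPOTHESIS `HChart` (the chart law of the translated interior gauge variables, = the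
content of (4.6)–(4.8) / HOME/GAPS.md G-C2-23) and two displayed geometric readings (PROVED otherwise).**

statement-level skeleton of published theorems with citation tags; proofs where landed; nothing here is a claim about the Yang–Mills mass gap

THE PRINT (verbatim; pp. 301–303 read this session as images `lit-balaban-p02/pages/original-p045-x2.png`, `lit-balaban-r16/renders/cmp114/original-
p046-x2.png`, `-p047-x2.png`).  (5.12.2)–(5.12.3): *"The 'interior' integral is (1/𝒩)∫dφ^{(k)}|_{Λ₁₀} dA^{(k)}|_{Λ^{c*c}_{10}} δ_{Ax,Λ′_{10}}(A^{(k)})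
δ_{Λ′^{c*c}_{10}}(QA^{(k)}) χ′_{Λ₇} Π F^{m̄}_{k,loc}(X_{σ₁}) × exp[−½⟨Λ₁₀φ, (Δ_{k,loc}(u_{k+1}) + aL⁻²P(u_{k+1}))(Λ₁₀ + 2Λ^c_{10})φ⟩ − ½⟨Λ^{c*c}_{10}A,
∂*σ_{k,loc}∂(Λ^{c*c}_{10} + 2Λ^{c*}_{10})A⟩ − V^{(k)}]. (5.12.2) Here 𝒩 is defined by the last integral, but without χ′_{Λ₇}, F^{m̄}_{k,loc}, or V^{(k)}. … The
4-th and 5-th forms, with Z_{Λ^{c*c}_{10}}, are a calculation of ∫dA|_{Λ^{c*c}_{10}} δ_{Ax,Λ′_{10}}(A) δ_{Λ′^{c*c}_{10}}(QA) (e_k/2π)^{‖Λ^{c*c}_{10}‖} exp[−½⟨Λ^{c*c}_{10}A,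
∂*σ_{k,loc}∂(Λ^{c*c}_{10} + 2Λ^{c*}_{10})A⟩]. (5.12.3) The factors e_k/2π come from the replacement of du^{(k)} with dA^{(k)} for the free variables; for the
constrained variables the replacement is compensated by a removal of the e_k/2π factor from the δ-functions, see (4.6)–(4.8). We calculate (5.12.3)
by means of a translation A^{(k)} = A^{(k)′} − Λ^{c*c}_{10}Q^{s*}QΛ^{c*}_{10}A^{(k)}, (5.12.4)"*; (5.12.7): *"Here dμ^{(k)}_{Λ₁₀} is an uncentered, normalized
Gaussian measure, dμ_{Λ₁₀}(A″, φ″) = (1/𝒩) dA″|_{Λ^{c*c}_{10}} dφ″|_{Λ₁₀} δ_{Ax,Λ′_{10}}(A″) δ_{Λ′^{c*c}_{10}}(QΛ^{c*c}_{10}A″) × exp[…]"*.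

THE READING (G-C2-23, owner CONCUR 2026-08-22T05:05Z, referee ref-5 CONCUR).  In the tree's frame (`BIJ88Eq5128Frame.isDC_of_isDT`, gen 10)
the interior gauge variables are the untranslated `U(1)` bond variables `u|_{Λ^{c*c}_{10}}` under the product of one-bond laws (`Interior.μIU`); the
bracket reads them through the translation `u′_Λ(u)` (`uCut`).  Print's `A^{(k)}` are the Lie-algebra coordinates `A_b = (ie_k)⁻¹ log u′_b` (branch
(2.11) of [2]) of the TRANSLATED variables; (5.12.3)/(5.12.7) integrate Lebesgue measure over the affine constraint set `{δ_{Ax}, δ(QA″)}`,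
parametrized after (5.12.4) by free coordinates `x`, `Λ^{c*c}A = Ex − Ra` (`a = Λ^{c*}A`; p02's `BIJ88ExteriorForms5121`: `expo523`, `constrInt523`,
`precK`, `fourthForm`, `fifthForm`, `Zgauge`), and `𝒩` is the ℝ-GAUSSIAN mass.  The exact content of *"the replacement of du with dA … compensated by
a removal of the e_k/2π factor from the δ-functions"* is the MEASURE-LEVEL STATEMENT, for each frozen exterior configuration `e`:
  `HChart`:  law of the translated interior variables `y = u′_Λ(u_e(i))|_{Λ^{c*c}_{10}}` under `Π_{b∈Λ^{c*c}_{10}} m_b`, RESTRICTED TO THE SMALL-FIELD WINDOW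
  `{|A(y)_b| ≤ r}`, `=` `c ·` (image of Lebesgue measure on the UNWRAPPED box `{x : |(Ex − Ra(e))_b| ≤ r}` under `x ↦ (e^{ie_k(Ex − Ra(e))_b})_b`),
with a constant `c` (print: `(e_k/2π)^{‖Λ^{c*c}_{10}‖}` up to the `L`-powers it absorbs, p. 275 *"We have incorporated some rescaling factors (powers of
L) … into the constant"*).  THIS FILE TAKES `HChart` AS A DISPLAYED HYPOTHESIS (its discharge on the torus = this seat's companion files
`BIJ88InteriorHaarChart` (the chart, step (i)), `BIJ88InteriorFibration46` (the `δ(QA″)` fibration at group level), `BIJ88FreeCoordinates48` ((4.8)),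
and the linearization of `Q` (p31's `BIJ88Eq536Linearization`)) and PROVES everything downstream of it.

WHAT IS PROVED (0 `sorry`; no `Prop`-valued fact; standard axioms).
 §1 `IsDC.congr_inner` — *"the frame with a general exterior normalizer"*: the display (5.12.8) depends on the exterior bracket `X_t` and the interior
    law `μ_t` only through `X_t · ∫B_t dμ_t`, so ANY re-normalization `(X, μ) → (X′, μ′)` with `X·∫B dμ = X′·∫B dμ′` is allowed (the frame's `𝒩` is the
    Haar-fibre total weight; print's `𝒩` is the ℝ-Gaussian mass — G-C2-23).
 §2 The Lie-algebra coordinate `aOf e_k u = (ie_k)⁻¹ log u` (branch `[−π, π)`), `aOf_expU1` (`= A` on `|e_kA| < π`, p31's `argB_toC_phaseField`).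
 §3 THE PRINTED GAUGE WEIGHT ON THE TORUS CONFIGURATION: `aIn`/`aOut` (interior/exterior translated Lie-algebra variables of a configuration), **`gW`**
    `= exp(expo523 (aIn q) (aOut q))` = `exp[−½⟨Λ^{c*c}A, T(Λ^{c*c} + 2Λ^{c*})A⟩]` (p02's `expo523_eq_printed`; `T` = the matrix of `∂*σ_{k,loc}∂`, abstract),
    **`hfac_gauge`** — the frame's factorization hypothesis DISCHARGED for brackets `X₀ · gW · exp(−½⟨φ, M_t(v)φ⟩) · B₀` (via F2's `hfac_product` with
    `Wg := gW`), the weight data: `measurable_gW`, `gW_pos`, `gW_le` (bounded: `|A_b| ≤ π/e_k`), `integrable_gW_fibre`.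
 §4 The translated interior variables `yInt e i₁`, the affine chart `affChart e x = (e^{ie_k(Ex − Ra(e))_b})_b`, the unwrapped box `box e`, the window
    `win`; the swap lemma `map_withDensity_comp`.
 §5 THE MEASURE-LEVEL CHAIN (given `HChart` at `e`, the exterior reading `haOut` and the re-translation invariance `hBretr` of `B`): the weighted
    interior law pushed along the re-translation and restricted to the window IS `c·Z_{Λ^{c*c}}e^{fourthForm+fifthForm}·𝒩_scalar ·` (glued image of
    `(muA (precK T E) (Eᵀℓ(a))).restrict box ⊗ Π du^{(j)}|_{int} ⊗ muφ.map chartIn⁻¹`) — **`weighted_window_eq`**; p02's `eq5123_calc`/`expo523_freeCoords`,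
    F2's `condMeasure_tilt`, F1's `calN` machinery BY NAME.
 §6 **`inner_integral_eq`**: `∫_{fibre} gW·sW·B = 𝒩′(e) · ∫ B dκ(e)` for every measurable `B` vanishing off the window (print: `B ⊇ χ′_{Λ₇} ⊇` the
    small-field characteristic functions of (5.9.4) *"|A^{(k)}| ≤ cp(e_k)"*) and invariant under re-translation.
 §7 **`eq5128_gauge`** — ROW C2.Eq5.12.8 WITH BOTH SECTORS BY NAME modulo `HChart`: `IsDC` with exterior bracket
    `X₀·exp(−½⟨Λ₁₀ᶜφ,MΛ₁₀ᶜφ⟩)·[c·Zgauge·e^{fourthForm+fifthForm}]·[Zscalar·e^{thirdForm}]`, interior law `κ` = glued `(muA|_{box})-chart ⊗ Πdu^{(j)} ⊗ muφ-chart`,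
    interior bracket `B₀`; instances `eq5128_gauge_axial` (`𝒟u δ_{Ax}`) and `eq5128_gauge_axial_qU` (locality by name, r18's `qU`).
HONEST SCOPE.  `HChart` (per term and exterior configuration), `haOut` (the exterior translated variables do not see the interior ones — print's
geometry: the surface bonds of a block bond with both blocks outside `Λ′_{10}` are exterior) and `hBretr`/`hBwin` (the interior bracket is a function of
the translated variables supported in the window) are HYPOTHESES, displayed; the constant `c`, the matrices `T`, `E`, `R`, `M` are abstract (their
identification with `∂*σ_{k,loc}∂`, r18's `free48` basis, `Λ^{c*c}Q^{s*}QΛ^{c*}`, `Δ_k(u_{k+1}) + aL⁻²P(u_{k+1})` is the business of rows C2.Eq5.12.1-5.12.7 /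
C2.Eq4.8); the box indicator stays in the interior law (`muA` restricted to the unwrapped box — *"invisible under χ′"* in print, kept here); the
previous-field factors `Π_{j<k}` of the interior are carried as the plain Haar product (their Gaussians (4.6) at `j < k` are rows C2.Eq4.6/4.9); no bound.
Seat p34 gen 12, file G1 (own lineage = the C1/C2 renormalization-transformation line at measure level; TAKING line HOME/STATUS.md 2026-08-22T07:19Z).

CITATION HEADER (lean-in-tree rule).  Part of the lit-balaban TYPED SKELETON (HOME `run/shared/lean/pub/lit-balaban/`), PHASE-2 proof seat p34
gen 12 (unit `lit-balaban-p34-g12`).  Rows served: **`C2.Eq5.12.8`** (gauge half of the recorded flip condition of `HOME/lit-balaban-r16/ROWS-C2-part2.md`,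
owner r16, 2026-08-22T06:50:20Z: *"Wg of `BIJ88Eq5127ProductMeasure` instantiated by name with the printed gauge Gaussian via the U(1)^{Ib} box chart
(G-C2-23)"*) and support **`C2.Eq5.12.1-5.12.7`** ((5.12.3), (5.12.7) gauge factor).  Built BY NAME on F2 `BIJ88Eq5127ProductMeasure` (`hfac_product`,
`condMeasure_tilt`, `condMeasure_prod`), F1 `BIJ88Eq5128ScalarSector` (`sW`, `sX`, `chartIn`, `calN` machinery), p02's `BIJ88ExteriorForms5121` /
`BIJ88Measure5127`, p10's `BIJ88Conditioning512`, r02/r14's `B2Eq228Conditioning`, r18's `BIJ85BlockAveragesTorus` (`qU`, `expU1`, `argB`), p31's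
`BIJ88Eq536Linearization` (`argB_toC_phaseField`), gen 10's frame; nothing restated.  PDF held: `paper:balaban1988-cmp114-bij-abelian-higgs-effective-action`
(journal page = PDF page + 256).  Imports Literature + Mathlib only.
-/

namespace Literature.MathematicalPhysics.QuantumFieldTheory.BalabanImbrieJaffe1984to88.BIJ88Eq5127GaugeSector

open Literature.MathematicalPhysics.QuantumFieldTheory.Balaban1983to89
open BIJ88Sect3Statements (U1 toC)
open BIJ85Sect1Model (HiggsField argB argB_mem_Ico)
open BIJ85BlockAveragesTorus (qU expU1 toC_expU1 measurable_qU measurable_argB measurable_expU1)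
open BIJ88InductiveForm41 (Prev)
open BIJ88Eq596Display (uCut vCut vCut_apply IsDT)
open BIJ88Eq531TranslLawCutoff (measurable_uCut)
open BIJ88Eq5128CondExpect (condNorm condMeasure condNorm_pos integral_condMeasure integral_condMeasure_mul lintegral_weight_eq
  condMeasure_const_mul)
open BIJ88Eq5128Split (Cfg UCfg PCfg cfgMeasure prevPi Interior)
open BIJ88Eq5128Display (IsDC termMeasure termIntegrand readEntry axialLaw)
open BIJ88Eq5128Display.Weight (normW condW normW_glue integral_condW_glue)
open BIJ88Eq5128Frame (isDC_of_isDT isDT_axial_iff)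
open BIJ88Eq5128ScalarSector (RIdx realCoords inIx xOf yOf chartIn chartOut Mq Mq_congr sW sX sX_freeze yOf_freeze xOf_glue yOf_glue
  measurable_sW sW_pos sW_glue integrable_wIn_cpl measurePreserving_chartIn integral_chartIn normW_sW calN_eq_Zscalar_mul_exp_thirdForm
  integral_μInt_scalar integrable_sW_fibre)
open BIJ88Eq5127ProductMeasure (pW gaugePart normG hfac_product measurable_pW pW_pos condMeasure_tilt condMeasure_map_equiv condMeasure_comp_equiv)
open B2Eq228Conditioning (In Out resIn resOut glue blkIn blkMix blkMix' blkOut gaussProb tilt_eq integrable_gaussWeight gaussWeight_pos integral_tilt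
  integrable_tilt)
open BIJ88Conditioning512 (wIn cpl calN srcJ wIn_mul_cpl calN_pos)
open BIJ88ExteriorForms5121 (Zscalar thirdForm expo523 constrInt523 precK covK Zgauge fourthForm fifthForm linForm5125 expo523_freeCoords eq5123_calc
  Zgauge_pos)
open BIJ88Measure5127 (muA muφ)
open scoped BigOperators ENNReal Matrix Real
open _root_.MeasureTheory _root_.MeasureTheory.Measure Function Set

noncomputable section

attribute [local instance 1001] Subtype.fintype

variable {P : Params} {k : ℕ}

/-! ## §1 The frame with a general exterior normalizer: `IsDC` sees only `X_t · ∫B_t dμ_t` -/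

section Renorm

variable {ι : Type*} {terms : Finset ι} {Λ : ι → Finset (PBond P (k+1))} {Qu : GaugeField P k U1 → GaugeField P (k+1) U1}
variable {ext : ι → Measure (Cfg P k)} {X X' B B' : ι → Cfg P k → GaugeField P (k+1) U1 → HiggsField P (k+1) → ℂ}
variable {cond cond' : ι → Cfg P k → GaugeField P (k+1) U1 → HiggsField P (k+1) → Measure (Cfg P k)}
variable {ρL : GaugeField P (k+1) U1 → HiggsField P (k+1) → ℂ}

/-- **RE-NORMALIZATION OF THE DISPLAY (5.12.8)** — the display depends on the exterior bracket and the interior law only through the product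
`X_t(q)·∫B_t dμ_t[q]`: if `X·∫B dμ = X′·∫B′ dμ′` pointwise in `(t, q, v′, ψ)` then `IsDC … X μ B ρ ↔`-direction `IsDC … X′ μ′ B′ ρ`.  This is the freedom print
uses when it normalizes by the ℝ-Gaussian mass `𝒩` of (5.12.2)/(5.12.3) rather than by the Haar-fibre total weight of the frame (G-C2-23: *"the
multiply-and-divide identity of p. 300 holds for ANY positive normalizer of the exterior variables"*). [cite: BalabanImbrieJaffe1988, (5.12.8) p.303] -/
theorem _root_.Literature.MathematicalPhysics.QuantumFieldTheory.BalabanImbrieJaffe1984to88.BIJ88Eq5128Display.IsDC.congr_inner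
    (h : IsDC terms Λ Qu ext X cond B ρL)
    (hXB : ∀ t ∈ terms, ∀ q v' ψ, X t q v' ψ * (∫ q', B t q' v' ψ ∂cond t q v' ψ) = X' t q v' ψ * (∫ q', B' t q' v' ψ ∂cond' t q v' ψ)) :
    IsDC terms Λ Qu ext X' cond' B' ρL := fun g hg hb => by
  rw [h g hg hb]
  refine Finset.sum_congr rfl fun t ht => ?_
  simp only [hXB t ht]

end Renorm

/-! ## §2 The Lie-algebra coordinate `A_b = (ie_k)⁻¹ log u_b` -/

section LieCoord

/-- **`A = (ie_k)⁻¹ log u`** — the Lie-algebra coordinate of a `U(1)` bond variable with the branch (2.11) of [2] (`argB ∈ [−π, π)`, r18's carrier),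
charge `e_k` ([2] (2.12): *"A_b = (ie(ε))^{−1} ln u_b"*; p. 280: *"u′_b = e^{ie_kA′_b}"*). [cite: BalabanImbrieJaffe1988, (5.3.1) p.280] -/
def aOf (ek : ℝ) (u : U1) : ℝ := argB (toC u) / ek

/-- kernel: `aOf` is measurable. [cite: BalabanImbrieJaffe1988, (5.3.1) p.280] -/
theorem measurable_aOf (ek : ℝ) : Measurable (aOf ek) :=
  (measurable_argB.comp BIJ85RT33.measurable_toC).div_const ek

/-- kernel: `|A| ≤ π/e_k` — the coordinate ranges over one period (`e_k > 0`). [cite: BalabanImbrieJaffe1988, (5.3.1) p.280] -/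
theorem abs_aOf_le {ek : ℝ} (hek : 0 < ek) (u : U1) : |aOf ek u| ≤ π / ek := by
  have h := argB_mem_Ico (toC u)
  rw [aOf, abs_div, abs_of_pos hek, div_le_div_iff_of_pos_right hek, abs_le]
  exact ⟨h.1, h.2.le⟩

/-- **The chart inverts the coordinate on the principal window**: `aOf e_k (e^{ie_kA}) = A` for `e_kA ∈ [−π, π)` (p31's `argB_toC_phaseField`).
[cite: BalabanImbrieJaffe1988, (5.3.1) p.280] -/
theorem aOf_expU1 {ek A : ℝ} (hek : ek ≠ 0) (hA : ek * A ∈ Set.Ico (-π) π) : aOf ek (expU1 (ek * A)) = A := by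
  rw [aOf, toC_expU1, show ((ek * A : ℝ) : ℂ) * Complex.I = ↑(ek * A) * Complex.I from rfl,
    BIJ85SmallFieldSplit64.argB_exp_mul_I hA]
  field_simp

/-- kernel: a window of half-width `r` with `e_kr < π` lies inside the principal branch: `|A| ≤ r ⟹ e_kA ∈ [−π, π)` (`e_k > 0`).
[cite: BalabanImbrieJaffe1988, (5.3.1) p.280] -/
theorem mul_mem_Ico_of_abs_le {ek r A : ℝ} (hek : 0 < ek) (hr : ek * r < π) (hA : |A| ≤ r) : ek * A ∈ Set.Ico (-π) π := by
  have h1 : |ek * A| ≤ ek * r := by rw [abs_mul, abs_of_pos hek]; exact mul_le_mul_of_nonneg_left hA hek.le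
  rw [abs_le] at h1
  constructor <;> linarith [h1.1, h1.2]

end LieCoord

/-! ## §3 The printed gauge weight on the torus configuration -/

section Weight

variable {ι : Type*} (Λ : ι → Finset (PBond P (k+1))) (D : ι → Interior P k)

/-- the interior predicate on bonds, `b ∈ Λ^{(k)c*c}_{10} = D.Ib` (so that p02's `In`/`Out` are the interior/exterior bond sets of the frame).
[cite: BalabanImbrieJaffe1988, (5.12.3) p.301] -/
abbrev inIb (D₀ : Interior P k) (b : PBond P k) : Prop := b ∈ D₀.Ib

variable (ek : ℝ)

/-- **`Λ^{(k)c*c}_{10}A^{(k)}` read on a configuration**: the Lie-algebra coordinates of the TRANSLATED interior bond variables `u′_{Λ_t}(u)|_{Λ^{c*c}_{10}}`.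
[cite: BalabanImbrieJaffe1988, (5.12.3) p.301] -/
def aIn (t : ι) (q : Cfg P k) : In (inIb (D t)) → ℝ := fun b => aOf ek (uCut qU (Λ t) q.1 b.1)

/-- **`Λ^{(k)c*}_{10}A^{(k)}` read on a configuration**: the Lie-algebra coordinates of the translated EXTERIOR bond variables.
[cite: BalabanImbrieJaffe1988, (5.12.3) p.301] -/
def aOut (t : ι) (q : Cfg P k) : Out (inIb (D t)) → ℝ := fun b => aOf ek (uCut qU (Λ t) q.1 b.1)

variable (T : ι → Matrix (PBond P k) (PBond P k) ℝ)

/-- **THE PRINTED GAUGE WEIGHT OF (5.12.2)/(5.12.3)/(5.12.7) ON THE CONFIGURATION SPACE**: `exp[−½⟨Λ^{c*c}_{10}A, T(Λ^{c*c}_{10} + 2Λ^{c*}_{10})A⟩]`, `T` the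
matrix of `∂*σ_{k,loc}∂` (p02's `expo523`; `expo523_eq_printed`), in the coordinates `aIn`/`aOut`. [cite: BalabanImbrieJaffe1988, (5.12.3) p.301] -/
def gW (t : ι) (q : Cfg P k) : ℝ := Real.exp (expo523 (inIb (D t)) (T t) (aIn Λ D ek t q) (aOut Λ D ek t q))

variable {Λ D ek T}

/-- kernel: the gauge weight is strictly positive. [cite: BalabanImbrieJaffe1988, (5.12.7) p.302] -/
theorem gW_pos (t : ι) (q : Cfg P k) : 0 < gW Λ D ek T t q := Real.exp_pos _

/-- kernel: the interior coordinates are jointly measurable in the configuration. [cite: BalabanImbrieJaffe1988, (5.12.3) p.301] -/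
theorem measurable_aIn (t : ι) : Measurable (aIn Λ D ek t : Cfg P k → In (inIb (D t)) → ℝ) :=
  measurable_pi_lambda _ fun b => (measurable_aOf ek).comp ((measurable_pi_apply b.1).comp ((measurable_uCut (Λ t)).comp measurable_fst))

/-- kernel: the exterior coordinates are jointly measurable in the configuration. [cite: BalabanImbrieJaffe1988, (5.12.3) p.301] -/
theorem measurable_aOut (t : ι) : Measurable (aOut Λ D ek t : Cfg P k → Out (inIb (D t)) → ℝ) :=
  measurable_pi_lambda _ fun b => (measurable_aOf ek).comp ((measurable_pi_apply b.1).comp ((measurable_uCut (Λ t)).comp measurable_fst))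

/-- kernel: p02's exponent `expo523` is jointly measurable in its two arguments. [cite: BalabanImbrieJaffe1988, (5.12.3) p.301] -/
theorem measurable_expo523 {S : Type} [Fintype S] (p : S → Prop) [DecidablePred p] (T₀ : Matrix S S ℝ) {α : Type*} [MeasurableSpace α]
    {a' : α → In p → ℝ} (ha' : Measurable a') {a : α → Out p → ℝ} (ha : Measurable a) :
    Measurable fun z => expo523 p T₀ (a' z) (a z) := by
  have h1 : ∀ i, Measurable fun z => a' z i := fun i => (measurable_pi_apply i).comp ha'
  have h2 : ∀ i, Measurable fun z => a z i := fun i => (measurable_pi_apply i).comp ha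
  unfold BIJ88ExteriorForms5121.expo523
  simp only [dotProduct, Matrix.mulVec, blkIn, blkMix', Matrix.submatrix_apply]
  exact ((measurable_const.mul (Finset.measurable_sum _ fun i _ => (h1 i).mul
    (Finset.measurable_sum _ fun j _ => measurable_const.mul (h1 j)))).sub
    (Finset.measurable_sum _ fun i _ => (h2 i).mul (Finset.measurable_sum _ fun j _ => measurable_const.mul (h1 j))))

/-- **The gauge weight is jointly measurable** (the datum `hWgm` of F2). [cite: BalabanImbrieJaffe1988, (5.12.7) p.302] -/
theorem measurable_gW (t : ι) : Measurable fun p : Cfg P k × (GaugeField P (k+1) U1 × HiggsField P (k+1)) => gW Λ D ek T t p.1 := by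
  unfold gW
  exact Real.measurable_exp.comp (measurable_expo523 _ _ ((measurable_aIn t).comp measurable_fst) ((measurable_aOut t).comp measurable_fst))

/-- kernel: measurability in the configuration alone. [cite: BalabanImbrieJaffe1988, (5.12.7) p.302] -/
theorem measurable_gW₁ (t : ι) : Measurable (gW Λ D ek T t : Cfg P k → ℝ) := by
  unfold gW
  exact Real.measurable_exp.comp (measurable_expo523 _ _ (measurable_aIn t) (measurable_aOut t))

/-- a bound for the exponent on the period box: `|expo523 a′ a| ≤ (π/e_k)²·(½ΣΣ|T_in| + ΣΣ|T_mix|)` when all coordinates are `≤ π/e_k` in absolute value.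
[cite: BalabanImbrieJaffe1988, (5.12.3) p.301] -/
def expoBound {S : Type} [Fintype S] (p : S → Prop) [DecidablePred p] (T₀ : Matrix S S ℝ) (ek : ℝ) : ℝ :=
  (π / ek) ^ 2 * ((1 / 2 : ℝ) * ∑ i : In p, ∑ j : In p, |blkIn p T₀ i j| + ∑ i : Out p, ∑ j : In p, |blkMix' p T₀ i j|)

/-- kernel: the exponent is bounded on the period box. [cite: BalabanImbrieJaffe1988, (5.12.3) p.301] -/
theorem abs_expo523_le {S : Type} [Fintype S] (p : S → Prop) [DecidablePred p] (T₀ : Matrix S S ℝ) {ek : ℝ} (hek : 0 < ek)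
    {a' : In p → ℝ} {a : Out p → ℝ} (ha' : ∀ i, |a' i| ≤ π / ek) (ha : ∀ i, |a i| ≤ π / ek) :
    |expo523 p T₀ a' a| ≤ expoBound p T₀ ek := by
  have hπ : 0 ≤ π / ek := by positivity
  have hq : ∀ (m : Type) [Fintype m] (N : Matrix m (In p) ℝ) (v : m → ℝ), (∀ i, |v i| ≤ π / ek) →
      |v ⬝ᵥ (N *ᵥ a')| ≤ (π / ek) ^ 2 * ∑ i, ∑ j, |N i j| := by
    intro m _ N v hv
    calc |v ⬝ᵥ (N *ᵥ a')| = |∑ i, v i * ∑ j, N i j * a' j| := by simp only [dotProduct, Matrix.mulVec]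
      _ ≤ ∑ i, |v i * ∑ j, N i j * a' j| := Finset.abs_sum_le_sum_abs _ _
      _ ≤ ∑ i, (π / ek) * ∑ j, |N i j| * (π / ek) := by
          refine Finset.sum_le_sum fun i _ => ?_
          rw [abs_mul]
          refine mul_le_mul (hv i) ((Finset.abs_sum_le_sum_abs _ _).trans (Finset.sum_le_sum fun j _ => ?_)) (abs_nonneg _) hπ
          rw [abs_mul]
          exact mul_le_mul_of_nonneg_left (ha' j) (abs_nonneg _)
      _ = (π / ek) ^ 2 * ∑ i, ∑ j, |N i j| := by
          simp only [Finset.mul_sum]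
          exact Finset.sum_congr rfl fun i _ => Finset.sum_congr rfl fun j _ => by ring
  have h1 := hq (In p) (blkIn p T₀) a' ha'
  have h2 := hq (Out p) (blkMix' p T₀) a ha
  unfold BIJ88ExteriorForms5121.expo523 expoBound
  calc |-(1 / 2 : ℝ) * (a' ⬝ᵥ (blkIn p T₀ *ᵥ a')) - a ⬝ᵥ (blkMix' p T₀ *ᵥ a')|
      ≤ |-(1 / 2 : ℝ) * (a' ⬝ᵥ (blkIn p T₀ *ᵥ a'))| + |a ⬝ᵥ (blkMix' p T₀ *ᵥ a')| := abs_sub _ _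
    _ = (1 / 2 : ℝ) * |a' ⬝ᵥ (blkIn p T₀ *ᵥ a')| + |a ⬝ᵥ (blkMix' p T₀ *ᵥ a')| := by
        rw [abs_mul, abs_neg, abs_of_pos (by norm_num : (0 : ℝ) < 1 / 2)]
    _ ≤ (1 / 2 : ℝ) * ((π / ek) ^ 2 * ∑ i, ∑ j, |blkIn p T₀ i j|) + (π / ek) ^ 2 * ∑ i, ∑ j, |blkMix' p T₀ i j| := by
        gcongr
    _ = _ := by ring

/-- **The gauge weight is bounded** on the whole configuration space (`|A_b| ≤ π/e_k` for every coordinate): `gW ≤ exp(expoBound)` (`e_k > 0`).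
[cite: BalabanImbrieJaffe1988, (5.12.7) p.302] -/
theorem gW_le (hek : 0 < ek) (t : ι) (q : Cfg P k) : gW Λ D ek T t q ≤ Real.exp (expoBound (inIb (D t)) (T t) ek) := by
  unfold gW
  exact Real.exp_le_exp.mpr ((le_abs_self _).trans (abs_expo523_le _ _ hek (fun _ => abs_aOf_le hek _) (fun _ => abs_aOf_le hek _)))

end Weight

/-! ## §3b The factorization of the frame for the full printed weight; weight data -/

section Fac

variable {ι : Type*} {Λ : ι → Finset (PBond P (k+1))} {D : ι → Interior P k} {ek : ℝ} {T : ι → Matrix (PBond P k) (PBond P k) ℝ}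
variable {M : ι → GaugeField P (k+1) U1 → Matrix (RIdx P k) (RIdx P k) ℝ}

/-- the gauge weight as the abstract gauge factor `Wg` of F2 (it does not depend on `v′`, `ψ`). [cite: BalabanImbrieJaffe1988, (5.12.7) p.302] -/
abbrev gWg (Λ : ι → Finset (PBond P (k+1))) (D : ι → Interior P k) (ek : ℝ) (T : ι → Matrix (PBond P k) (PBond P k) ℝ)
    (t : ι) (q : Cfg P k) (_v' : GaugeField P (k+1) U1) (_ψ : HiggsField P (k+1)) : ℝ := gW Λ D ek T t q

/-- **THE FACTORIZATION `hfac` OF THE FRAME FOR THE FULL PRINTED WEIGHT OF (5.12.7)** — bracket read on configurations =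
`X₀ · exp[−½⟨Λ^{c*c}A, T(Λ^{c*c}+2Λ^{c*})A⟩] · exp(−½⟨φ^{(k)}, M_t(v)φ^{(k)}⟩) · B₀` ⟹ it factors as (exterior factor at the frozen configuration) ×
(`gW · sW`) × `B₀` (F2's `hfac_product` with `Wg := gW`). [cite: BalabanImbrieJaffe1988, (5.12.7) p.302] -/
theorem hfac_gauge {terms : Finset ι} (hMs : ∀ t v, (M t v).IsSymm)
    {J : ι → Prev P k → GaugeField P k U1 → GaugeField P (k+1) U1 → HiggsField P k → HiggsField P (k+1) → ℂ}
    {X₀ B₀ : ι → Cfg P k → GaugeField P (k+1) U1 → HiggsField P (k+1) → ℂ}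
    (hv : ∀ t ∈ terms, ∀ (q : Cfg P k) (v' : GaugeField P (k+1) U1), vCut qU (Λ t) ((D t).freeze q).1 v' = vCut qU (Λ t) q.1 v')
    (hX₀ : ∀ t ∈ terms, ∀ q v' ψ, X₀ t ((D t).freeze q) v' ψ = X₀ t q v' ψ)
    (hJ : ∀ t ∈ terms, ∀ q v' ψ, readEntry Λ qU J t q v' ψ =
      X₀ t q v' ψ * (gW Λ D ek T t q : ℂ) *
        (Real.exp (-(1 / 2 : ℝ) * (realCoords q.2.2 ⬝ᵥ (M t (vCut qU (Λ t) q.1 v') *ᵥ realCoords q.2.2))) : ℂ) * B₀ t q v' ψ) :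
    ∀ t ∈ terms, ∀ (q : Cfg P k) (v' : GaugeField P (k+1) U1) (ψ : HiggsField P (k+1)),
      J t q.2.1 (uCut qU (Λ t) q.1) (vCut qU (Λ t) q.1 v') q.2.2 ψ =
        (X₀ t ((D t).freeze q) v' ψ * (sX Λ qU D M t ((D t).freeze q) v' : ℂ)) *
          (pW Λ qU D M (gWg Λ D ek T) t q v' ψ : ℂ) * B₀ t q v' ψ :=
  hfac_product (Wg := gWg Λ D ek T) hMs hv hX₀ hJ

/-- kernel: the gauge weight does not see the interior scalar variables (F2's datum `hWgX`): at a glued configuration it depends on the gauge and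
previous-field variables only. [cite: BalabanImbrieJaffe1988, (5.12.7) p.302] -/
theorem gW_glue_gaugePart (t : ι) (e : (D t).Ext) (i : (D t).Int) :
    gW Λ D ek T t ((D t).glue e i) = gW Λ D ek T t ((D t).glue e (gaugePart (D t) (i.1, i.2.1))) := by
  have h1 : ((D t).glue e i).1 = ((D t).glue e (gaugePart (D t) (i.1, i.2.1))).1 := by
    funext b
    by_cases hb : b ∈ (D t).Ib
    · rw [Interior.glue_fst_of_mem _ _ _ hb, Interior.glue_fst_of_mem _ _ _ hb]; rfl
    · rw [Interior.glue_fst_of_not_mem _ _ _ hb, Interior.glue_fst_of_not_mem _ _ _ hb]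
  unfold gW aIn aOut
  rw [h1]

variable {m : PBond P k → Measure U1} [∀ b, IsProbabilityMeasure (m b)]

/-- **The gauge weight is integrable over each gauge fibre** (F2's datum `hWgi`): it is measurable and bounded and the fibre law is finite.
[cite: BalabanImbrieJaffe1988, (5.12.7) p.302] -/
theorem integrable_gW_fibre (hek : 0 < ek) (t : ι) (e : (D t).Ext) :
    Integrable (fun ab => gW Λ D ek T t ((D t).glue e (gaugePart (D t) ab))) (((D t).μIU m).prod (D t).μIP) := by
  have hmeas : Measurable fun ab : (D t).IU × (D t).IP => gW Λ D ek T t ((D t).glue e (gaugePart (D t) ab)) :=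
    (measurable_gW₁ t).comp (((D t).measurableEmbedding_glue e).measurable.comp (BIJ88Eq5127ProductMeasure.measurable_gaugePart (D t)))
  haveI : IsFiniteMeasure (((D t).μIU m).prod (D t).μIP) := by
    unfold BIJ88Eq5128Split.Interior.μIU BIJ88Eq5128Split.Interior.μIP
    infer_instance
  refine Integrable.of_bound hmeas.aestronglyMeasurable (Real.exp (expoBound (inIb (D t)) (T t) ek))
    (Filter.Eventually.of_forall fun ab => ?_)
  rw [Real.norm_eq_abs, abs_of_pos (gW_pos t _)]
  exact gW_le hek t _

end Fac

/-! ## §4 The translated interior variables, the affine chart of (5.12.4), the window; a swap lemma -/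

section Data

variable {ι : Type*} (Λ : ι → Finset (PBond P (k+1))) (D : ι → Interior P k) (ek : ℝ) (T : ι → Matrix (PBond P k) (PBond P k) ℝ)
variable {ιf : ι → Type} [∀ t, Fintype (ιf t)]
variable (E : (t : ι) → Matrix (In (inIb (D t))) (ιf t) ℝ) (R : (t : ι) → Matrix (In (inIb (D t))) (Out (inIb (D t))) ℝ) (r : ℝ)

/-- kernel: `x ↦ Nx` is measurable. [cite: BalabanImbrieJaffe1988, (5.12.4) p.301] -/
theorem measurable_mulVec' {m' n : Type} [Fintype m'] [Fintype n] (N : Matrix m' n ℝ) : Measurable fun x : n → ℝ => N *ᵥ x :=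
  (continuous_const.matrix_mulVec continuous_id).measurable

/-- kernel: `x ↦ ⟨j, x⟩` is measurable. [cite: BalabanImbrieJaffe1988, (5.12.5) p.301] -/
theorem measurable_dotProduct_const {n : Type} [Fintype n] (j : n → ℝ) : Measurable fun x : n → ℝ => j ⬝ᵥ x := by
  unfold dotProduct
  exact Finset.measurable_sum _ fun i _ => measurable_const.mul (measurable_pi_apply i)

/-- kernel: `x ↦ ⟨x, Kx⟩` is measurable. [cite: BalabanImbrieJaffe1988, (5.12.3) p.301] -/
theorem measurable_quadForm' {n : Type} [Fintype n] (K : Matrix n n ℝ) : Measurable fun x : n → ℝ => x ⬝ᵥ (K *ᵥ x) := by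
  unfold dotProduct
  exact Finset.measurable_sum _ fun i _ => (measurable_pi_apply i).mul ((measurable_pi_apply i).comp (measurable_mulVec' K))

/-- **The translated interior gauge variables as a function of the interior gauge variables** (exterior frozen at `e`):
`y = u′_{Λ_t}(u_e(i₁))|_{Λ^{c*c}_{10}}`. [cite: BalabanImbrieJaffe1988, (5.12.7) p.302] -/
def yInt (t : ι) (e : (D t).Ext) (i₁ : (D t).IU) : (D t).IU := fun b => uCut qU (Λ t) ((D t).glue e (i₁, (D t).base.2)).1 b.1

/-- **THE AFFINE CHART OF THE CONSTRAINT SET AFTER (5.12.4)**: free coordinates `x ↦ (e^{ie_k(Ex − Ra)_b})_{b∈Λ^{c*c}_{10}}`, `a = Λ^{c*}A` the exterior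
translated variables at `e`. [cite: BalabanImbrieJaffe1988, (5.12.4) p.301] -/
def affChart (t : ι) (e : (D t).Ext) (x : ιf t → ℝ) : (D t).IU :=
  fun b => expU1 (ek * ((E t *ᵥ x - R t *ᵥ aOut Λ D ek t ((D t).glue e (D t).base)) b))

/-- **The unwrapped small-field box** `{x : |(Ex − Ra)_b| ≤ r ∀b}` — the support of print's small-field characteristic functions *"|A^{(k)}(b)| ≤ cp(e_k)"*
(p. 297, (5.9.4)) in the free coordinates. [cite: BalabanImbrieJaffe1988, (5.9.4) p.297] -/
def box (t : ι) (e : (D t).Ext) : Set (ιf t → ℝ) := {x | ∀ b, |(E t *ᵥ x - R t *ᵥ aOut Λ D ek t ((D t).glue e (D t).base)) b| ≤ r}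

/-- **The small-field window of the translated interior variables** `{y : |A(y)_b| ≤ r ∀b}`. [cite: BalabanImbrieJaffe1988, (5.9.4) p.297] -/
def win (t : ι) : Set (D t).IU := {y | ∀ b, |aOf ek (y b)| ≤ r}

variable {Λ D ek T E R r}

/-- kernel: the gauge part of a glued configuration does not depend on the interior previous-field/scalar slots.
[cite: BalabanImbrieJaffe1988, (5.12.8) p.303] -/
theorem glue_fst_eq (t : ι) (e : (D t).Ext) (i₁ : (D t).IU) (r₁ r₂ : (D t).IP × (D t).IX) :
    ((D t).glue e (i₁, r₁)).1 = ((D t).glue e (i₁, r₂)).1 := by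
  funext b
  by_cases hb : b ∈ (D t).Ib
  · rw [Interior.glue_fst_of_mem _ _ _ hb, Interior.glue_fst_of_mem _ _ _ hb]
  · rw [Interior.glue_fst_of_not_mem _ _ _ hb, Interior.glue_fst_of_not_mem _ _ _ hb]

/-- kernel: the interior coordinates at a glued configuration are those of the translated interior variables. [cite: BalabanImbrieJaffe1988, (5.12.7) p.302] -/
theorem aIn_glue (t : ι) (e : (D t).Ext) (i : (D t).Int) :
    aIn Λ D ek t ((D t).glue e i) = fun b => aOf ek (yInt Λ D t e i.1 b) := by
  funext b
  simp only [aIn, yInt]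
  rw [glue_fst_eq t e i.1 (D t).base.2 i.2]

/-- kernel: `yInt` is measurable. [cite: BalabanImbrieJaffe1988, (5.12.7) p.302] -/
theorem measurable_yInt (t : ι) (e : (D t).Ext) : Measurable (yInt Λ D t e) := by
  refine measurable_pi_iff.mpr fun b => ?_
  have hg : Measurable fun i₁ : (D t).IU => (D t).glue e (i₁, (D t).base.2) :=
    ((D t).measurableEmbedding_glue e).measurable.comp (measurable_id.prodMk measurable_const)
  exact (measurable_pi_apply b.1).comp ((measurable_uCut (Λ t)).comp (measurable_fst.comp hg))

/-- kernel: the affine chart is measurable. [cite: BalabanImbrieJaffe1988, (5.12.4) p.301] -/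
theorem measurable_affChart (t : ι) (e : (D t).Ext) : Measurable (affChart Λ D ek E R t e) := by
  refine measurable_pi_iff.mpr fun b => measurable_expU1.comp (measurable_const.mul ?_)
  exact (measurable_pi_apply b).comp ((measurable_mulVec' (E t)).sub measurable_const)

/-- kernel: the box is measurable. [cite: BalabanImbrieJaffe1988, (5.9.4) p.297] -/
theorem measurableSet_box (t : ι) (e : (D t).Ext) : MeasurableSet (box Λ D ek E R r t e) := by
  have h : box Λ D ek E R r t e = ⋂ b, {x | |(E t *ᵥ x - R t *ᵥ aOut Λ D ek t ((D t).glue e (D t).base)) b| ≤ r} := by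
    ext x; simp [box]
  rw [h]
  refine MeasurableSet.iInter fun b => measurableSet_le ?_ measurable_const
  exact ((measurable_pi_apply b).comp ((measurable_mulVec' (E t)).sub measurable_const)).abs

/-- kernel: the window is measurable. [cite: BalabanImbrieJaffe1988, (5.9.4) p.297] -/
theorem measurableSet_win (t : ι) : MeasurableSet (win (D := D) ek r t) := by
  have h : win (D := D) ek r t = ⋂ b, {y : (D t).IU | |aOf ek (y b)| ≤ r} := by ext y; simp [win]
  rw [h]
  exact MeasurableSet.iInter fun b => measurableSet_le (((measurable_aOf ek).comp (measurable_pi_apply b)).abs) measurable_const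

/-- kernel: on the box the chart lands in the window and the coordinate is read back exactly (`e_k > 0`, `e_kr < π`).
[cite: BalabanImbrieJaffe1988, (5.3.1) p.280] -/
theorem aOf_affChart (hek : 0 < ek) (hr : ek * r < π) (t : ι) (e : (D t).Ext) {x : ιf t → ℝ} (hx : x ∈ box Λ D ek E R r t e)
    (b : In (inIb (D t))) :
    aOf ek (affChart Λ D ek E R t e x b) = (E t *ᵥ x - R t *ᵥ aOut Λ D ek t ((D t).glue e (D t).base)) b :=
  aOf_expU1 hek.ne' (mul_mem_Ico_of_abs_le hek hr (hx b))

/-- **SWAP LEMMA**: `(μ with density g∘f) pushed by f = (f_*μ) with density g`. [cite: BalabanImbrieJaffe1988, (5.12.7) p.302] -/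
theorem map_withDensity_comp {α β : Type*} [MeasurableSpace α] [MeasurableSpace β] (μ : Measure α) {f : α → β} (hf : Measurable f)
    {g : β → ℝ≥0∞} (hg : Measurable g) : (μ.withDensity (g ∘ f)).map f = (μ.map f).withDensity g := by
  ext s hs
  rw [Measure.map_apply hf hs, withDensity_apply _ (hf hs), withDensity_apply _ hs, setLIntegral_map hs hg hf]
  rfl

/-- **The un-normalized weighted measure is `𝒩 ·` the normalized one**: `w·μ = 𝒩 · (𝒩⁻¹ w·μ)` for an integrable weight `w ≥ 0` with `𝒩 > 0`.
[cite: BalabanImbrieJaffe1988, (5.12.2) p.301] -/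
theorem withDensity_eq_smul_condMeasure {α : Type*} [MeasurableSpace α] {μ : Measure α} {w : α → ℝ} (hw0 : ∀ a, 0 ≤ w a)
    (hwi : Integrable w μ) (hN : 0 < condNorm μ w) :
    μ.withDensity (fun a => ENNReal.ofReal (w a)) = ENNReal.ofReal (condNorm μ w) • condMeasure μ w := by
  rw [condMeasure, smul_smul, lintegral_weight_eq hw0 hwi, ENNReal.mul_inv_cancel (by simpa using hN) ENNReal.ofReal_ne_top, one_smul]

end Data

/-! ## §5 The measure-level chain on one interior fibre -/

section Chain

variable {ι : Type*} {Λ : ι → Finset (PBond P (k+1))} {D : ι → Interior P k} {ek : ℝ} {T : ι → Matrix (PBond P k) (PBond P k) ℝ}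
variable {M : ι → GaugeField P (k+1) U1 → Matrix (RIdx P k) (RIdx P k) ℝ}
variable {ιf : ι → Type} [∀ t, Fintype (ιf t)] [∀ t, DecidableEq (ιf t)]
variable {E : (t : ι) → Matrix (In (inIb (D t))) (ιf t) ℝ} {R : (t : ι) → Matrix (In (inIb (D t))) (Out (inIb (D t))) ℝ} {c : ι → ℝ} {r : ℝ}
variable {m : PBond P k → Measure U1} [∀ b, IsProbabilityMeasure (m b)]

/-- the gauge weight as a function of the translated interior variables, exterior frozen at `e`. [cite: BalabanImbrieJaffe1988, (5.12.3) p.301] -/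
def gTil (Λ : ι → Finset (PBond P (k+1))) (D : ι → Interior P k) (ek : ℝ) (T : ι → Matrix (PBond P k) (PBond P k) ℝ) (t : ι)
    (e : (D t).Ext) (y : (D t).IU) : ℝ :=
  Real.exp (expo523 (inIb (D t)) (T t) (fun b => aOf ek (y b)) (aOut Λ D ek t ((D t).glue e (D t).base)))

/-- the scalar weight as a function of the interior scalar variables, exterior frozen at `e` (F1's `sW_glue`). [cite: BalabanImbrieJaffe1988, (5.12.2) p.301] -/
def sTil (Λ : ι → Finset (PBond P (k+1))) (D : ι → Interior P k) (M : ι → GaugeField P (k+1) U1 → Matrix (RIdx P k) (RIdx P k) ℝ) (t : ι)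
    (e : (D t).Ext) (v' : GaugeField P (k+1) U1) (ix : (D t).IX) : ℝ :=
  wIn (inIx (D t)) (M t (vCut qU (Λ t) ((D t).glue e (D t).base).1 v')) (chartIn (D t) ix) *
    cpl (inIx (D t)) (M t (vCut qU (Λ t) ((D t).glue e (D t).base).1 v')) (chartIn (D t) ix) (chartOut (D t) e.2.2)

/-- kernel: `gTil` is measurable. [cite: BalabanImbrieJaffe1988, (5.12.3) p.301] -/
theorem measurable_gTil (t : ι) (e : (D t).Ext) : Measurable (gTil Λ D ek T t e) := by
  unfold gTil
  exact Real.measurable_exp.comp (measurable_expo523 _ _ (measurable_pi_lambda _ fun b => (measurable_aOf ek).comp (measurable_pi_apply b))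
    measurable_const)

/-- kernel: `sTil` is measurable. [cite: BalabanImbrieJaffe1988, (5.12.2) p.301] -/
theorem measurable_sTil (t : ι) (e : (D t).Ext) (v' : GaugeField P (k+1) U1) : Measurable (sTil Λ D M t e v') := by
  unfold sTil
  exact BIJ88Eq5128ScalarSector.measurable_wIn_cpl (inIx (D t)) (A := fun _ => M t (vCut qU (Λ t) ((D t).glue e (D t).base).1 v'))
    (fun _ _ => measurable_const) (chartIn (D t)).measurable measurable_const

/-- **The printed weight on an interior fibre is (gauge factor of the translated interior variables) × (scalar factor of the interior scalar
variables)** — given the exterior reading `haOut` (the exterior translated variables do not see the interior ones) and the locality `hvq` of the block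
field. [cite: BalabanImbrieJaffe1988, (5.12.7) p.302] -/
theorem pW_glue_eq (t : ι) (e : (D t).Ext) (v' : GaugeField P (k+1) U1) (ψ : HiggsField P (k+1))
    (haOut : ∀ i : (D t).Int, aOut Λ D ek t ((D t).glue e i) = aOut Λ D ek t ((D t).glue e (D t).base))
    (hvq : ∀ q : Cfg P k, vCut qU (Λ t) ((D t).freeze q).1 v' = vCut qU (Λ t) q.1 v') (i : (D t).Int) :
    pW Λ qU D M (gWg Λ D ek T) t ((D t).glue e i) v' ψ = gTil Λ D ek T t e (yInt Λ D t e i.1) * sTil Λ D M t e v' i.2.2 := by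
  rw [pW, gWg, gW, aIn_glue, haOut i, sW_glue t v' hvq e i]
  rfl

variable (Λ D ek T M E R c r m)

/-- **`HChart` — THE DISPLAYED CHART HYPOTHESIS** (the measure-level content of *"the replacement of du^{(k)} with dA^{(k)} for the free variables;
for the constrained variables the replacement is compensated by a removal of the e_k/2π factor from the δ-functions, see (4.6)–(4.8)"* together
with the translation (5.12.4), for the term `t` at the frozen exterior configuration `e`): the law of the translated interior gauge variables under the
interior one-bond laws, restricted to the small-field window, is `c_t` times the image of Lebesgue measure on the unwrapped box under the affine chart.
A `Prop`-valued DEFINITION used as a HYPOTHESIS of the theorems below (never asserted). [cite: BalabanImbrieJaffe1988, (5.12.3) p.301] -/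
def HChart (t : ι) (e : (D t).Ext) : Prop :=
  (((D t).μIU m).map (yInt Λ D t e)).restrict (win (D := D) ek r t) =
    ENNReal.ofReal (c t) • ((volume : Measure (ιf t → ℝ)).restrict (box Λ D ek E R r t e)).map (affChart Λ D ek E R t e)

/-- **THE INTERIOR LAW OF (5.12.7) ON THE FIBRE, BY NAME** (before gluing): the product of p02's gauge Gaussian `muA (precK T E) (Eᵀℓ(a))` — free
coordinates of the constraint set, covariance `C_{Λ^{c*c}_{10}}`, mean from the linear form (5.12.5) — restricted to the unwrapped box and charted, the
Haar product of the interior previous-field variables, and p02's scalar Gaussian `muφ (M_Λ) (J(y))` in real coordinates (F2's `condMeasure_tilt`).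
[cite: BalabanImbrieJaffe1988, (5.12.7) p.302] -/
def lawInt (t : ι) (e : (D t).Ext) (v' : GaugeField P (k+1) U1) : Measure (D t).Int :=
  (((muA (precK (inIb (D t)) (T t) (E t))
      ((E t)ᵀ *ᵥ linForm5125 (inIb (D t)) (T t) (R t) (aOut Λ D ek t ((D t).glue e (D t).base)))).restrict
      (box Λ D ek E R r t e)).map (affChart Λ D ek E R t e)).prod
    ((D t).μIP.prod
      ((muφ (blkIn (inIx (D t)) (M t (vCut qU (Λ t) ((D t).glue e (D t).base).1 v')))
        (srcJ (inIx (D t)) (M t (vCut qU (Λ t) ((D t).glue e (D t).base).1 v')) (chartOut (D t) e.2.2))).map (chartIn (D t)).symm))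

/-- **THE EXTERIOR NORMALIZER OF PRINT**: `𝒩′ = c · Z_{Λ^{c*c}_{10}} · e^{fourthForm + fifthForm} · 𝒩_scalar` (`𝒩_scalar` = p10's `calN` = `Z_{Λ₁₀}(u_{k+1})·e^{thirdForm}`,
F1's `calN_eq_Zscalar_mul_exp_thirdForm`). [cite: BalabanImbrieJaffe1988, (5.12.1) p.301] -/
def normPrint (t : ι) (e : (D t).Ext) (v' : GaugeField P (k+1) U1) : ℝ :=
  c t * (Zgauge (inIb (D t)) (T t) (E t) *
    Real.exp (fourthForm (inIb (D t)) (T t) (R t) (aOut Λ D ek t ((D t).glue e (D t).base)) +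
      fifthForm (inIb (D t)) (T t) (R t) (E t) (aOut Λ D ek t ((D t).glue e (D t).base)))) *
    calN (inIx (D t)) (M t (vCut qU (Λ t) ((D t).glue e (D t).base).1 v')) (chartOut (D t) e.2.2)

variable {Λ D ek T M E R c r m}

/-- the retraction `(i₁, rest) ↦ (u′(i₁)|_{int}, rest)` replacing the interior gauge variables by their translated values.
[cite: BalabanImbrieJaffe1988, (5.12.4) p.301] -/
def retr (Λ : ι → Finset (PBond P (k+1))) (D : ι → Interior P k) (t : ι) (e : (D t).Ext) (i : (D t).Int) : (D t).Int :=
  (yInt Λ D t e i.1, i.2)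

/-- kernel: `retr` is measurable. [cite: BalabanImbrieJaffe1988, (5.12.4) p.301] -/
theorem measurable_retr (t : ι) (e : (D t).Ext) : Measurable (retr Λ D t e) :=
  ((measurable_yInt t e).comp measurable_fst).prodMk measurable_snd

omit [∀ b, IsProbabilityMeasure (m b)] in
/-- **STEP 1 — the weighted interior measure is a product** (gauge factor on the gauge variables, scalar factor on the scalar variables).
[cite: BalabanImbrieJaffe1988, (5.12.7) p.302] -/
theorem weighted_eq_prod (t : ι) (e : (D t).Ext) (v' : GaugeField P (k+1) U1) (ψ : HiggsField P (k+1))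
    (haOut : ∀ i : (D t).Int, aOut Λ D ek t ((D t).glue e i) = aOut Λ D ek t ((D t).glue e (D t).base))
    (hvq : ∀ q : Cfg P k, vCut qU (Λ t) ((D t).freeze q).1 v' = vCut qU (Λ t) q.1 v') :
    ((D t).μInt m).withDensity (fun i => ENNReal.ofReal (pW Λ qU D M (gWg Λ D ek T) t ((D t).glue e i) v' ψ)) =
      (((D t).μIU m).withDensity (fun i₁ => ENNReal.ofReal (gTil Λ D ek T t e (yInt Λ D t e i₁)))).prod
        (((D t).μIP.prod (volume : Measure (D t).IX)).withDensity fun w => ENNReal.ofReal (sTil Λ D M t e v' w.2)) := by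
  have hg : Measurable fun i₁ : (D t).IU => ENNReal.ofReal (gTil Λ D ek T t e (yInt Λ D t e i₁)) :=
    ((measurable_gTil t e).comp (measurable_yInt t e)).ennreal_ofReal
  have hs : Measurable fun w : (D t).IP × (D t).IX => ENNReal.ofReal (sTil Λ D M t e v' w.2) :=
    ((measurable_sTil t e v').comp measurable_snd).ennreal_ofReal
  unfold BIJ88Eq5128Split.Interior.μInt
  rw [prod_withDensity hg hs]
  refine withDensity_congr_ae (Filter.Eventually.of_forall fun i => ?_)
  dsimp only
  rw [pW_glue_eq t e v' ψ haOut hvq i]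
  exact ENNReal.ofReal_mul (show 0 ≤ gTil Λ D ek T t e (yInt Λ D t e i.1) from (Real.exp_pos _).le)

/-- **STEP 2 — the scalar factor BY NAME**: `(Πdu^{(j)}|_{int} ⊗ dφ″) with density sW = 𝒩_scalar · Πdu^{(j)}|_{int} ⊗ (muφ in real coordinates)`
(F2's `condMeasure_tilt`, p10's `wIn_mul_cpl`, the volume-preserving chart of F1). [cite: BalabanImbrieJaffe1988, (5.12.7) p.302] -/
theorem scalar_withDensity_eq (hMs : ∀ t v, (M t v).IsSymm) (hMpd : ∀ t v, (blkIn (inIx (D t)) (M t v)).PosDef)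
    (t : ι) (e : (D t).Ext) (v' : GaugeField P (k+1) U1) :
    ((D t).μIP.prod (volume : Measure (D t).IX)).withDensity (fun w => ENNReal.ofReal (sTil Λ D M t e v' w.2)) =
      ENNReal.ofReal (calN (inIx (D t)) (M t (vCut qU (Λ t) ((D t).glue e (D t).base).1 v')) (chartOut (D t) e.2.2)) •
        (D t).μIP.prod
          ((muφ (blkIn (inIx (D t)) (M t (vCut qU (Λ t) ((D t).glue e (D t).base).1 v')))
            (srcJ (inIx (D t)) (M t (vCut qU (Λ t) ((D t).glue e (D t).base).1 v')) (chartOut (D t) e.2.2))).map (chartIn (D t)).symm) := by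
  set A := M t (vCut qU (Λ t) ((D t).glue e (D t).base).1 v') with hA
  set y := chartOut (D t) e.2.2 with hy
  set wf : (In (inIx (D t)) → ℝ) → ℝ := fun x => wIn (inIx (D t)) A x * cpl (inIx (D t)) A x y with hwf
  have hwfm : Measurable wf := BIJ88Eq5128ScalarSector.measurable_wIn_cpl (inIx (D t)) (A := fun _ => A) (fun _ _ => measurable_const)
    measurable_id measurable_const
  have hwf0 : ∀ x, 0 ≤ wf x := fun x => by
    simp only [hwf, wIn, cpl]; exact (mul_pos (Real.exp_pos _) (Real.exp_pos _)).le
  have hwfi : Integrable wf := integrable_wIn_cpl (inIx (D t)) (A := A) (hMs t _) (hMpd t _) y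
  -- the scalar density on `IX` is `wf ∘ chartIn`
  have hsd : (fun w : (D t).IP × (D t).IX => ENNReal.ofReal (sTil Λ D M t e v' w.2)) = fun w => 1 * (fun ix => ENNReal.ofReal (wf (chartIn (D t) ix))) w.2 := by
    funext w; rw [one_mul]; rfl
  have hsm : Measurable fun ix : (D t).IX => ENNReal.ofReal (wf (chartIn (D t) ix)) := (hwfm.comp (chartIn (D t)).measurable).ennreal_ofReal
  rw [hsd, ← prod_withDensity measurable_const hsm]
  have h1 : (D t).μIP.withDensity (fun _ => (1 : ℝ≥0∞)) = (D t).μIP := withDensity_one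
  rw [h1]
  -- `dφ″|_{IX}` is the image of Lebesgue measure in real coordinates
  have hvol : (volume : Measure (D t).IX) = (volume : Measure (In (inIx (D t)) → ℝ)).map (chartIn (D t)).symm :=
    ((measurePreserving_chartIn (D t)).symm (chartIn (D t))).map_eq.symm
  have h2 : (volume : Measure (D t).IX).withDensity (fun ix => ENNReal.ofReal (wf (chartIn (D t) ix))) =
      ((volume : Measure (In (inIx (D t)) → ℝ)).withDensity fun x => ENNReal.ofReal (wf x)).map (chartIn (D t)).symm := by
    rw [GaussianToolkit.map_withDensity_equiv, ← hvol]
    congr 1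
  have h3 : (volume : Measure (In (inIx (D t)) → ℝ)).withDensity (fun x => ENNReal.ofReal (wf x)) =
      ENNReal.ofReal (calN (inIx (D t)) A y) • muφ (blkIn (inIx (D t)) A) (srcJ (inIx (D t)) A y) := by
    have hN : condNorm volume wf = calN (inIx (D t)) A y := rfl
    rw [withDensity_eq_smul_condMeasure hwf0 hwfi (by rw [hN]; exact calN_pos (inIx (D t)) A (hMpd t _) y), hN]
    congr 1
    have hw : wf = fun x => Real.exp (-(srcJ (inIx (D t)) A y ⬝ᵥ x) - 1 / 2 * (x ⬝ᵥ (blkIn (inIx (D t)) A *ᵥ x))) :=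
      funext fun x => wIn_mul_cpl (inIx (D t)) A (hMs t _) x y
    rw [hw, condMeasure_tilt (hMpd t _)]
  haveI : IsProbabilityMeasure (muφ (blkIn (inIx (D t)) A) (srcJ (inIx (D t)) A y)) :=
    BIJ88Measure5127.isProbabilityMeasure_muφ _ _ (hMpd t _)
  rw [h2, h3, Measure.map_smul, Measure.prod_smul_right]

omit [∀ t, DecidableEq (ιf t)] in
/-- kernel: on the box the gauge factor of the chart is p02's translated integrand of (5.12.3): `gTil(affChart x) = exp(expo523(Ex − Ra, a)) =
e^{fourthForm(a)} · exp(−⟨Eᵀℓ(a), x⟩ − ½⟨x, Kx⟩)` (`expo523_freeCoords`). [cite: BalabanImbrieJaffe1988, (5.12.5) p.301] -/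
theorem gTil_affChart (hek : 0 < ek) (hr : ek * r < π) (hT : ∀ t, (T t).IsSymm) (t : ι) (e : (D t).Ext) {x : ιf t → ℝ}
    (hx : x ∈ box Λ D ek E R r t e) :
    gTil Λ D ek T t e (affChart Λ D ek E R t e x) =
      Real.exp (fourthForm (inIb (D t)) (T t) (R t) (aOut Λ D ek t ((D t).glue e (D t).base))) *
        Real.exp (-(((E t)ᵀ *ᵥ linForm5125 (inIb (D t)) (T t) (R t) (aOut Λ D ek t ((D t).glue e (D t).base))) ⬝ᵥ x) -
          1 / 2 * (x ⬝ᵥ (precK (inIb (D t)) (T t) (E t) *ᵥ x))) := by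
  have hco : (fun b => aOf ek (affChart Λ D ek E R t e x b)) = E t *ᵥ x - R t *ᵥ aOut Λ D ek t ((D t).glue e (D t).base) :=
    funext fun b => aOf_affChart hek hr t e hx b
  rw [gTil, hco, expo523_freeCoords _ _ _ _ (hT t), ← Real.exp_add]
  ring_nf

/-- **STEP 3 — the gauge factor BY NAME on the unwrapped box**: Lebesgue measure on the box with density `gTil ∘ affChart` IS `Z_{Λ^{c*c}} e^{fourthForm +
fifthForm}` times p02's Gaussian `muA (precK) (Eᵀℓ)` restricted to the box (`eq5123_calc`: *"The 4-th and 5-th forms, with Z_{Λ^{c*c}_{10}}, are a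
calculation of (5.12.3)"*, `condMeasure_tilt`). [cite: BalabanImbrieJaffe1988, (5.12.3) p.301] -/
theorem gauge_withDensity_box_eq (hek : 0 < ek) (hr : ek * r < π) (hT : ∀ t, (T t).IsSymm) (hK : ∀ t, (precK (inIb (D t)) (T t) (E t)).PosDef)
    (t : ι) (e : (D t).Ext) :
    ((volume : Measure (ιf t → ℝ)).restrict (box Λ D ek E R r t e)).withDensity
        (fun x => ENNReal.ofReal (gTil Λ D ek T t e (affChart Λ D ek E R t e x))) =
      ENNReal.ofReal (Zgauge (inIb (D t)) (T t) (E t) *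
        Real.exp (fourthForm (inIb (D t)) (T t) (R t) (aOut Λ D ek t ((D t).glue e (D t).base)) +
          fifthForm (inIb (D t)) (T t) (R t) (E t) (aOut Λ D ek t ((D t).glue e (D t).base)))) •
      (muA (precK (inIb (D t)) (T t) (E t)) ((E t)ᵀ *ᵥ linForm5125 (inIb (D t)) (T t) (R t) (aOut Λ D ek t ((D t).glue e (D t).base)))).restrict
        (box Λ D ek E R r t e) := by
  set a := aOut Λ D ek t ((D t).glue e (D t).base) with ha
  set K := precK (inIb (D t)) (T t) (E t) with hK'
  set j := (E t)ᵀ *ᵥ linForm5125 (inIb (D t)) (T t) (R t) a with hj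
  set C4 := Real.exp (fourthForm (inIb (D t)) (T t) (R t) a) with hC4
  set wg : (ιf t → ℝ) → ℝ := fun x => Real.exp (-(j ⬝ᵥ x) - 1 / 2 * (x ⬝ᵥ (K *ᵥ x))) with hwg
  have hKpd : K.PosDef := hK t
  -- on the box the density is `C4 * wg`
  have hbox : ∀ᵐ x ∂(volume : Measure (ιf t → ℝ)).restrict (box Λ D ek E R r t e),
      ENNReal.ofReal (gTil Λ D ek T t e (affChart Λ D ek E R t e x)) = ENNReal.ofReal C4 * ENNReal.ofReal (wg x) := by
    refine (ae_restrict_iff' (measurableSet_box t e)).mpr (Filter.Eventually.of_forall fun x hx => ?_)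
    rw [gTil_affChart hek hr hT t e hx, ← ENNReal.ofReal_mul (Real.exp_pos _).le]
  rw [withDensity_congr_ae hbox]
  have hwgm : Measurable fun x => ENNReal.ofReal (wg x) :=
    (Real.measurable_exp.comp (((measurable_dotProduct_const j).neg).sub (measurable_const.mul (measurable_quadForm' K)))).ennreal_ofReal
  rw [show (fun x => ENNReal.ofReal C4 * ENNReal.ofReal (wg x)) = ENNReal.ofReal C4 • fun x => ENNReal.ofReal (wg x) from rfl,
    withDensity_smul _ hwgm, ← restrict_withDensity (measurableSet_box t e)]
  -- the full-space weighted measure is `‖wg‖ · muA K j`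
  have hwg0 : ∀ x, 0 ≤ wg x := fun x => (Real.exp_pos _).le
  have hwgi : Integrable wg := by
    have h := integrable_tilt hKpd j
    refine h.congr (Filter.Eventually.of_forall fun x => ?_)
    simp only [hwg]
  have hKs : K.IsSymm := by
    have h := hKpd.isHermitian.eq
    rwa [Matrix.conjTranspose_eq_transpose_of_trivial] at h
  have hdet : IsUnit K.det := isUnit_iff_ne_zero.2 hKpd.det_pos.ne'
  -- `‖wg‖ = Zgauge · e^{fifthForm}` : p02's calculation (`integral_tilt`)
  have hnorm : condNorm volume wg = Zgauge (inIb (D t)) (T t) (E t) * Real.exp (fifthForm (inIb (D t)) (T t) (R t) (E t) a) := by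
    have h1 : constrInt523 (inIb (D t)) (T t) (R t) (E t) a = C4 * condNorm volume wg := by
      rw [constrInt523, condNorm, ← integral_const_mul]
      refine integral_congr_ae (Filter.Eventually.of_forall fun x => ?_)
      simp only [hwg, hC4, hj, hK']
      rw [expo523_freeCoords _ _ _ _ (hT t), ← Real.exp_add]
      ring_nf
    have h2 := eq5123_calc (inIb (D t)) (T t) (R t) (E t) (hT t) (hK t) a
    rw [h1, Real.exp_add, hC4] at h2
    have hC4pos : 0 < Real.exp (fourthForm (inIb (D t)) (T t) (R t) a) := Real.exp_pos _
    have h3 : condNorm volume wg * Real.exp (fourthForm (inIb (D t)) (T t) (R t) a) =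
        (Zgauge (inIb (D t)) (T t) (E t) * Real.exp (fifthForm (inIb (D t)) (T t) (R t) (E t) a)) *
          Real.exp (fourthForm (inIb (D t)) (T t) (R t) a) := by
      calc condNorm volume wg * Real.exp (fourthForm (inIb (D t)) (T t) (R t) a)
          = Real.exp (fourthForm (inIb (D t)) (T t) (R t) a) * condNorm volume wg := mul_comm _ _
        _ = Zgauge (inIb (D t)) (T t) (E t) * (Real.exp (fourthForm (inIb (D t)) (T t) (R t) a) *
              Real.exp (fifthForm (inIb (D t)) (T t) (R t) (E t) a)) := h2
        _ = _ := by ring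
    exact mul_right_cancel₀ hC4pos.ne' h3
  have hNpos : 0 < condNorm volume wg := by rw [hnorm]; exact mul_pos (Zgauge_pos _ _ _ hKpd) (Real.exp_pos _)
  rw [withDensity_eq_smul_condMeasure hwg0 hwgi hNpos, condMeasure_tilt hKpd j, hnorm, Measure.restrict_smul, smul_smul,
    ← ENNReal.ofReal_mul (Real.exp_pos _).le]
  congr 2
  rw [Real.exp_add]
  ring

/-- **STEP 4 — THE WINDOWED, RE-TRANSLATED WEIGHTED INTERIOR LAW IS `𝒩′ ·` THE PRINTED INTERIOR LAW (5.12.7)** (on the fibre, before gluing), given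
`HChart` at `e`. [cite: BalabanImbrieJaffe1988, (5.12.7) p.302] -/
theorem weighted_window_eq (hek : 0 < ek) (hr : ek * r < π) (hT : ∀ t, (T t).IsSymm) (hK : ∀ t, (precK (inIb (D t)) (T t) (E t)).PosDef)
    (hMs : ∀ t v, (M t v).IsSymm) (hMpd : ∀ t v, (blkIn (inIx (D t)) (M t v)).PosDef) (hc : ∀ t, 0 ≤ c t)
    (t : ι) (e : (D t).Ext) (v' : GaugeField P (k+1) U1) (ψ : HiggsField P (k+1))
    (haOut : ∀ i : (D t).Int, aOut Λ D ek t ((D t).glue e i) = aOut Λ D ek t ((D t).glue e (D t).base))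
    (hvq : ∀ q : Cfg P k, vCut qU (Λ t) ((D t).freeze q).1 v' = vCut qU (Λ t) q.1 v')
    (hch : HChart Λ D ek E R c r m t e) :
    ((((D t).μInt m).withDensity (fun i => ENNReal.ofReal (pW Λ qU D M (gWg Λ D ek T) t ((D t).glue e i) v' ψ))).map (retr Λ D t e)).restrict
        (win (D := D) ek r t ×ˢ (Set.univ : Set ((D t).IP × (D t).IX))) =
      ENNReal.ofReal (normPrint Λ D ek T M E R c t e v') • lawInt Λ D ek T M E R r t e v' := by
  have hg : Measurable fun y : (D t).IU => ENNReal.ofReal (gTil Λ D ek T t e y) := (measurable_gTil t e).ennreal_ofReal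
  haveI : IsFiniteMeasure ((D t).μIU m) := by unfold BIJ88Eq5128Split.Interior.μIU; infer_instance
  haveI : IsProbabilityMeasure (muφ (blkIn (inIx (D t)) (M t (vCut qU (Λ t) ((D t).glue e (D t).base).1 v')))
      (srcJ (inIx (D t)) (M t (vCut qU (Λ t) ((D t).glue e (D t).base).1 v')) (chartOut (D t) e.2.2))) :=
    BIJ88Measure5127.isProbabilityMeasure_muφ _ _ (hMpd t _)
  haveI : SFinite (((D t).μIP.prod (volume : Measure (D t).IX)).withDensity fun w => ENNReal.ofReal (sTil Λ D M t e v' w.2)) := by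
    rw [scalar_withDensity_eq hMs hMpd t e v']; infer_instance
  -- step 1 and the retraction
  rw [weighted_eq_prod t e v' ψ haOut hvq, retr_eq_prodMap, ← Measure.map_prod_map _ _ (measurable_yInt t e) measurable_id, Measure.map_id,
    show (fun i₁ => ENNReal.ofReal (gTil Λ D ek T t e (yInt Λ D t e i₁))) = (fun y => ENNReal.ofReal (gTil Λ D ek T t e y)) ∘ yInt Λ D t e
      from rfl,
    map_withDensity_comp _ (measurable_yInt t e) hg]
  -- restriction to the window cylinder
  rw [← Measure.prod_restrict, Measure.restrict_univ, restrict_withDensity (measurableSet_win t), hch]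
  -- the gauge factor through the chart hypothesis, the scalar factor by name
  rw [withDensity_smul_measure, ← map_withDensity_comp _ (measurable_affChart t e) hg,
    show ((fun y => ENNReal.ofReal (gTil Λ D ek T t e y)) ∘ affChart Λ D ek E R t e) =
      fun x => ENNReal.ofReal (gTil Λ D ek T t e (affChart Λ D ek E R t e x)) from rfl,
    gauge_withDensity_box_eq hek hr hT hK t e, Measure.map_smul, scalar_withDensity_eq hMs hMpd t e v']
  -- collect the constants
  rw [smul_smul, Measure.prod_smul_left, Measure.prod_smul_right, smul_smul, normPrint, lawInt,
    ← ENNReal.ofReal_mul (hc t), ← ENNReal.ofReal_mul (mul_nonneg (hc t) (mul_pos (Zgauge_pos _ _ _ (hK t)) (Real.exp_pos _)).le)]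
  where
  /-- the retraction is the product map of `yInt` and the identity -/
  retr_eq_prodMap : retr Λ D t e = Prod.map (yInt Λ D t e) id := rfl

/-! ## §6 The interior integral of the frame equals `𝒩′ ·` the integral against the printed interior law -/

/-- kernel: `normW · ∫B dμ_{cond} = ∫ W·B` over the fibre — the normalization of the frame undone (for any measurable positive fibre-integrable
weight). [cite: BalabanImbrieJaffe1988, (5.12.2) p.301] -/
theorem normW_mul_integral_condW (t : ι) {W : Cfg P k → ℝ} (hWm : Measurable W) (hW0 : ∀ q, 0 < W q)
    (hWi : ∀ e : (D t).Ext, Integrable (fun i => W ((D t).glue e i)) ((D t).μInt m)) (e : (D t).Ext) (i : (D t).Int) (B : Cfg P k → ℂ) :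
    (normW (D t) m W ((D t).glue e i) : ℂ) * ∫ q', B q' ∂condW (D t) m W ((D t).glue e i) =
      ∫ i', (W ((D t).glue e i') : ℂ) * B ((D t).glue e i') ∂(D t).μInt m := by
  have hw : Measurable fun i' : (D t).Int => W ((D t).glue e i') := hWm.comp ((D t).measurableEmbedding_glue e).measurable
  have hN : 0 < condNorm ((D t).μInt m) (fun i' => W ((D t).glue e i')) := condNorm_pos (fun _ => hW0 _) (hWi e)
  rw [integral_condW_glue, integral_condMeasure_mul hw (fun _ => (hW0 _).le) (hWi e), normW_glue, ← mul_assoc, ← Complex.ofReal_mul,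
    mul_inv_cancel₀ hN.ne', Complex.ofReal_one, one_mul]

/-- kernel: the print normalizer is non-negative. [cite: BalabanImbrieJaffe1988, (5.12.7) p.302] -/
theorem normPrint_nonneg (hK : ∀ t, (precK (inIb (D t)) (T t) (E t)).PosDef) (hMpd : ∀ t v, (blkIn (inIx (D t)) (M t v)).PosDef)
    (hc : ∀ t, 0 ≤ c t) (t : ι) (e : (D t).Ext) (v' : GaugeField P (k+1) U1) : 0 ≤ normPrint Λ D ek T M E R c t e v' :=
  mul_nonneg (mul_nonneg (hc t) (mul_pos (Zgauge_pos _ _ _ (hK t)) (Real.exp_pos _)).le) (calN_pos _ _ (hMpd t _) _).le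

/-- **THE INTERIOR INTEGRAL BY NAME** — for fixed `(t, e, v′, ψ)`, given `HChart` at `e`, the exterior reading `haOut`, the locality `hvq`, and an interior
bracket `B` that is measurable, invariant under the re-translation of the interior gauge variables (`hBretr`), with the re-translation idempotent
(`hidem`), and vanishing off the small-field window of the interior translated coordinates (`hBwin`; print: `B ⊇ χ′_{Λ₇} ⊇` the characteristic
functions *"|A^{(k)}(b)| ≤ cp(e_k)"* of (5.9.4)):  `∫_{fibre} (gW·sW)·B dμInt = 𝒩′(e) · ∫ B d(glued printed interior law (5.12.7))`.
[cite: BalabanImbrieJaffe1988, (5.12.7) p.302] -/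
theorem inner_integral_eq (hek : 0 < ek) (hr : ek * r < π) (hT : ∀ t, (T t).IsSymm) (hK : ∀ t, (precK (inIb (D t)) (T t) (E t)).PosDef)
    (hMs : ∀ t v, (M t v).IsSymm) (hMpd : ∀ t v, (blkIn (inIx (D t)) (M t v)).PosDef) (hMm : ∀ t i j, Measurable fun v => M t v i j)
    (hc : ∀ t, 0 ≤ c t) (t : ι) (e : (D t).Ext) (v' : GaugeField P (k+1) U1) (ψ : HiggsField P (k+1))
    (haOut : ∀ i : (D t).Int, aOut Λ D ek t ((D t).glue e i) = aOut Λ D ek t ((D t).glue e (D t).base))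
    (hvq : ∀ q : Cfg P k, vCut qU (Λ t) ((D t).freeze q).1 v' = vCut qU (Λ t) q.1 v')
    (hidem : ∀ i₁ : (D t).IU, yInt Λ D t e (yInt Λ D t e i₁) = yInt Λ D t e i₁)
    (hch : HChart Λ D ek E R c r m t e) {B : Cfg P k → ℂ} (hBm : Measurable B)
    (hBretr : ∀ i : (D t).Int, B ((D t).glue e i) = B ((D t).glue e (retr Λ D t e i)))
    (hBwin : ∀ q : Cfg P k, B q ≠ 0 → ∀ b, |aIn Λ D ek t q b| ≤ r) :
    ∫ i, (pW Λ qU D M (gWg Λ D ek T) t ((D t).glue e i) v' ψ : ℂ) * B ((D t).glue e i) ∂(D t).μInt m =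
      (normPrint Λ D ek T M E R c t e v' : ℂ) * ∫ q, B q ∂(D t).fibreMeasure (lawInt Λ D ek T M E R r t e v') e := by
  set WM := ((D t).μInt m).withDensity (fun i => ENNReal.ofReal (pW Λ qU D M (gWg Λ D ek T) t ((D t).glue e i) v' ψ)) with hWM
  set C : Set (D t).Int := win (D := D) ek r t ×ˢ (Set.univ : Set ((D t).IP × (D t).IX)) with hC
  have hCm : MeasurableSet C := (measurableSet_win t).prod MeasurableSet.univ
  have hglue : Measurable ((D t).glue e) := ((D t).measurableEmbedding_glue e).measurable
  have hpm : Measurable fun i : (D t).Int => pW Λ qU D M (gWg Λ D ek T) t ((D t).glue e i) v' ψ :=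
    ((measurable_pW (Wg := gWg Λ D ek T) measurable_qU hMm measurable_gW t).comp (hglue.prodMk (measurable_const (a := (v', ψ)))) :)
  -- (a) the weighted measure
  have ha : ∫ i, (pW Λ qU D M (gWg Λ D ek T) t ((D t).glue e i) v' ψ : ℂ) * B ((D t).glue e i) ∂(D t).μInt m = ∫ i, B ((D t).glue e i) ∂WM := by
    rw [hWM, integral_withDensity_eq_integral_toReal_smul hpm.ennreal_ofReal (Filter.Eventually.of_forall fun _ => ENNReal.ofReal_lt_top)]
    refine integral_congr_ae (Filter.Eventually.of_forall fun i => ?_)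
    dsimp only
    rw [ENNReal.toReal_ofReal (pW_pos (Wg := gWg Λ D ek T) (fun t q _ _ => gW_pos t q) t _ v' ψ).le, Complex.real_smul]
  -- (b)+(c) the re-translation and the window
  have hbc : ∀ i : (D t).Int, B ((D t).glue e i) = (C.indicator fun i' => B ((D t).glue e i')) (retr Λ D t e i) := by
    intro i
    rw [hBretr i]
    by_cases hi : retr Λ D t e i ∈ C
    · rw [Set.indicator_of_mem hi]
    · rw [Set.indicator_of_notMem hi]
      by_contra hne
      apply hi
      refine Set.mk_mem_prod ?_ (Set.mem_univ _)
      intro b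
      have hw := hBwin _ hne b
      rw [retr, aIn_glue, hidem] at hw
      exact hw
  -- (d)+(e) push along the re-translation, restrict to the window cylinder
  have hde : ∫ i, B ((D t).glue e i) ∂WM = ∫ i, B ((D t).glue e i) ∂(WM.map (retr Λ D t e)).restrict C := by
    rw [← integral_indicator hCm, integral_map (measurable_retr t e).aemeasurable
      ((show Measurable fun i => B ((D t).glue e i) from hBm.comp hglue).indicator hCm).aestronglyMeasurable]
    exact integral_congr_ae (Filter.Eventually.of_forall hbc)
  -- (f)+(g) the identity of measures and the gluing
  rw [ha, hde, hWM, hC, weighted_window_eq hek hr hT hK hMs hMpd hc t e v' ψ haOut hvq hch, integral_smul_measure,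
    ENNReal.toReal_ofReal (normPrint_nonneg hK hMpd hc t e v'), Interior.integral_fibreMeasure, Complex.real_smul]

end Chain

/-! ## §7 Row C2.Eq5.12.8 with both sectors of the conditioning by name, modulo `HChart` -/

section Main

variable {ι : Type*} {Λ : ι → Finset (PBond P (k+1))} {D : ι → Interior P k} {ek : ℝ} {T : ι → Matrix (PBond P k) (PBond P k) ℝ}
variable {M : ι → GaugeField P (k+1) U1 → Matrix (RIdx P k) (RIdx P k) ℝ}
variable {ιf : ι → Type} [∀ t, Fintype (ιf t)] [∀ t, DecidableEq (ιf t)]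
variable {E : (t : ι) → Matrix (In (inIb (D t))) (ιf t) ℝ} {R : (t : ι) → Matrix (In (inIb (D t))) (Out (inIb (D t))) ℝ} {c : ι → ℝ} {r : ℝ}
variable {m : PBond P k → Measure U1} [∀ b, IsProbabilityMeasure (m b)]

/-- **ROW C2.Eq5.12.8 — (5.9.6) ⇒ (5.12.8) WITH THE GAUGE AND THE SCALAR SECTOR OF THE CONDITIONING BY NAME, MODULO `HChart`.**
DATA: the translated display (5.9.6) over `u ~ Π_b m_b` with brackets read on configurations as
`X₀ · exp[−½⟨Λ^{c*c}A, T(Λ^{c*c}+2Λ^{c*})A⟩] · exp(−½⟨φ^{(k)}, M_t(v)φ^{(k)}⟩) · B₀` (`X₀` interior-independent; `T_t` symmetric with `EᵀT_{in}E`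
positive definite — *"The inverse covariance is local and bounded from above and from below"*, p. 300; `M_t(v)` symmetric with positive definite
`Λ₁₀`-block, measurable entries), charge `e_k > 0`, window `e_kr < π`, chart constants `c_t ≥ 0`; the DISPLAYED readings `haOut` (exterior
translated variables interior-independent), `hidem` (re-translation idempotent), the interior bracket measurable, re-translation invariant and
supported in the window (`hBm`, `hBretr`, `hBwin`), the locality `hv`, and **`HChart`** for every term and exterior configuration.
CONCLUSION: `IsDC` with exterior measures `Π_{j≤k}du^{(j)}|_{Λ^{(j)c*}_{10}}dφ^{(k)}|_{Λ^{(k)c}_{10}}`, exterior bracket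
`X₀ · exp(−½⟨Λ₁₀ᶜφ, MΛ₁₀ᶜφ⟩) · [c·Z_{Λ^{c*c}_{10}}·e^{fourthForm+fifthForm}·Z_{Λ₁₀}-factor·e^{thirdForm}]` (`normPrint`; p02's `eq5123_calc`, p10's `calN`), interior law =
the glued `(muA (precK T E) (Eᵀℓ)|_{box} chart) ⊗ Πdu^{(j)}|_{int} ⊗ (muφ chart)` (`lawInt`, (5.12.7) BY NAME), interior bracket `B₀`.
[cite: BalabanImbrieJaffe1988, (5.12.8) p.303] -/
theorem eq5128_gauge {terms : Finset ι}
    {J : ι → Prev P k → GaugeField P k U1 → GaugeField P (k+1) U1 → HiggsField P k → HiggsField P (k+1) → ℂ}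
    {ρL : GaugeField P (k+1) U1 → HiggsField P (k+1) → ℂ}
    (h : IsDT (Measure.pi m) terms Λ qU J ρL)
    (hek : 0 < ek) (hr : ek * r < π) (hT : ∀ t, (T t).IsSymm) (hK : ∀ t, (precK (inIb (D t)) (T t) (E t)).PosDef)
    (hMs : ∀ t v, (M t v).IsSymm) (hMpd : ∀ t v, (blkIn (inIx (D t)) (M t v)).PosDef) (hMm : ∀ t i j, Measurable fun v => M t v i j)
    (hc : ∀ t, 0 ≤ c t)
    (X₀ B₀ : ι → Cfg P k → GaugeField P (k+1) U1 → HiggsField P (k+1) → ℂ)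
    (hv : ∀ t ∈ terms, ∀ (q : Cfg P k) (v' : GaugeField P (k+1) U1), vCut qU (Λ t) ((D t).freeze q).1 v' = vCut qU (Λ t) q.1 v')
    (hX₀ : ∀ t ∈ terms, ∀ q v' ψ, X₀ t ((D t).freeze q) v' ψ = X₀ t q v' ψ)
    (hJ : ∀ t ∈ terms, ∀ q v' ψ, readEntry Λ qU J t q v' ψ =
      X₀ t q v' ψ * (gW Λ D ek T t q : ℂ) *
        (Real.exp (-(1 / 2 : ℝ) * (realCoords q.2.2 ⬝ᵥ (M t (vCut qU (Λ t) q.1 v') *ᵥ realCoords q.2.2))) : ℂ) * B₀ t q v' ψ)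
    (haOut : ∀ t ∈ terms, ∀ (e : (D t).Ext) (i : (D t).Int), aOut Λ D ek t ((D t).glue e i) = aOut Λ D ek t ((D t).glue e (D t).base))
    (hidem : ∀ t ∈ terms, ∀ (e : (D t).Ext) (i₁ : (D t).IU), yInt Λ D t e (yInt Λ D t e i₁) = yInt Λ D t e i₁)
    (hBm : ∀ t v' ψ, Measurable fun q => B₀ t q v' ψ)
    (hBretr : ∀ t ∈ terms, ∀ (e : (D t).Ext) (i : (D t).Int) v' ψ, B₀ t ((D t).glue e i) v' ψ = B₀ t ((D t).glue e (retr Λ D t e i)) v' ψ)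
    (hBwin : ∀ t ∈ terms, ∀ q v' ψ, B₀ t q v' ψ ≠ 0 → ∀ b, |aIn Λ D ek t q b| ≤ r)
    (hch : ∀ t ∈ terms, ∀ e : (D t).Ext, HChart Λ D ek E R c r m t e)
    (hJi : ∀ t ∈ terms, Integrable (termIntegrand Λ qU J t) (termMeasure (Measure.pi m))) :
    IsDC terms Λ qU (fun t => (D t).extMeasure m)
      (fun t q v' ψ => X₀ t q v' ψ * (sX Λ qU D M t q v' : ℂ) * (normPrint Λ D ek T M E R c t ((D t).split q).1 v' : ℂ))
      (fun t q v' _ => (D t).fibreMeasure (lawInt Λ D ek T M E R r t ((D t).split q).1 v') ((D t).split q).1) B₀ ρL := by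
  -- the frame with the full printed weight `gW · sW`
  have h1 := isDC_of_isDT h measurable_qU D (fun t q v' ψ => X₀ t q v' ψ * (sX Λ qU D M t q v' : ℂ)) B₀ (pW Λ qU D M (gWg Λ D ek T)) hv
    (hfac_gauge hMs hv hX₀ hJ) (fun t _ => measurable_pW measurable_qU hMm measurable_gW t)
    (fun t _ q v' ψ => pW_pos (fun t q _ _ => gW_pos t q) t q v' ψ)
    (fun t ht e v' ψ => BIJ88Eq5127ProductMeasure.integrable_pW_fibre hMs hMpd t v' ψ (fun q => hv t ht q v')
      (fun e i => gW_glue_gaugePart t e i) (fun e => integrable_gW_fibre hek t e) e) hJi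
  -- re-normalize by print's `𝒩`
  refine h1.congr_inner fun t ht q v' ψ => ?_
  have hWm : Measurable fun q' : Cfg P k => pW Λ qU D M (gWg Λ D ek T) t q' v' ψ :=
    ((measurable_pW (Wg := gWg Λ D ek T) measurable_qU hMm measurable_gW t).comp (measurable_id.prodMk (measurable_const (a := (v', ψ)))) :)
  have hWi : ∀ e : (D t).Ext, Integrable (fun i => pW Λ qU D M (gWg Λ D ek T) t ((D t).glue e i) v' ψ) ((D t).μInt m) := fun e =>
    BIJ88Eq5127ProductMeasure.integrable_pW_fibre hMs hMpd t v' ψ (fun q => hv t ht q v') (fun e i => gW_glue_gaugePart t e i)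
      (fun e => integrable_gW_fibre hek t e) e
  obtain ⟨e, i, rfl⟩ : ∃ e i, q = (D t).glue e i := ⟨((D t).split q).1, ((D t).split q).2, ((D t).glue_split q).symm⟩
  simp only [Interior.split_glue]
  rw [mul_assoc, normW_mul_integral_condW t hWm (fun q' => pW_pos (Wg := gWg Λ D ek T) (fun t q _ _ => gW_pos t q) t q' v' ψ) hWi,
    inner_integral_eq hek hr hT hK hMs hMpd hMm hc t e v' ψ (haOut t ht e) (fun q' => hv t ht q' v') (hidem t ht e) (hch t ht e) (hBm t v' ψ)
      (fun i => hBretr t ht e i v' ψ) (fun q' => hBwin t ht q' v' ψ)]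
  ring

/-- **Instance `ν = 𝒟u δ_{Ax}`** (the measure of (5.9.6)/(5.12.8)): the same from `IsDT (axialMeasure P k U1) …`, interior one-bond laws `axialLaw`.
[cite: BalabanImbrieJaffe1988, (5.12.8) p.303] -/
theorem eq5128_gauge_axial {terms : Finset ι}
    {J : ι → Prev P k → GaugeField P k U1 → GaugeField P (k+1) U1 → HiggsField P k → HiggsField P (k+1) → ℂ}
    {ρL : GaugeField P (k+1) U1 → HiggsField P (k+1) → ℂ}
    (h : IsDT (BIJ88RenormTransf311.axialMeasure P k U1) terms Λ qU J ρL)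
    (hek : 0 < ek) (hr : ek * r < π) (hT : ∀ t, (T t).IsSymm) (hK : ∀ t, (precK (inIb (D t)) (T t) (E t)).PosDef)
    (hMs : ∀ t v, (M t v).IsSymm) (hMpd : ∀ t v, (blkIn (inIx (D t)) (M t v)).PosDef) (hMm : ∀ t i j, Measurable fun v => M t v i j)
    (hc : ∀ t, 0 ≤ c t)
    (X₀ B₀ : ι → Cfg P k → GaugeField P (k+1) U1 → HiggsField P (k+1) → ℂ)
    (hv : ∀ t ∈ terms, ∀ (q : Cfg P k) (v' : GaugeField P (k+1) U1), vCut qU (Λ t) ((D t).freeze q).1 v' = vCut qU (Λ t) q.1 v')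
    (hX₀ : ∀ t ∈ terms, ∀ q v' ψ, X₀ t ((D t).freeze q) v' ψ = X₀ t q v' ψ)
    (hJ : ∀ t ∈ terms, ∀ q v' ψ, readEntry Λ qU J t q v' ψ =
      X₀ t q v' ψ * (gW Λ D ek T t q : ℂ) *
        (Real.exp (-(1 / 2 : ℝ) * (realCoords q.2.2 ⬝ᵥ (M t (vCut qU (Λ t) q.1 v') *ᵥ realCoords q.2.2))) : ℂ) * B₀ t q v' ψ)
    (haOut : ∀ t ∈ terms, ∀ (e : (D t).Ext) (i : (D t).Int), aOut Λ D ek t ((D t).glue e i) = aOut Λ D ek t ((D t).glue e (D t).base))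
    (hidem : ∀ t ∈ terms, ∀ (e : (D t).Ext) (i₁ : (D t).IU), yInt Λ D t e (yInt Λ D t e i₁) = yInt Λ D t e i₁)
    (hBm : ∀ t v' ψ, Measurable fun q => B₀ t q v' ψ)
    (hBretr : ∀ t ∈ terms, ∀ (e : (D t).Ext) (i : (D t).Int) v' ψ, B₀ t ((D t).glue e i) v' ψ = B₀ t ((D t).glue e (retr Λ D t e i)) v' ψ)
    (hBwin : ∀ t ∈ terms, ∀ q v' ψ, B₀ t q v' ψ ≠ 0 → ∀ b, |aIn Λ D ek t q b| ≤ r)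
    (hch : ∀ t ∈ terms, ∀ e : (D t).Ext, HChart Λ D ek E R c r (axialLaw P k) t e)
    (hJi : ∀ t ∈ terms, Integrable (termIntegrand Λ qU J t) (termMeasure (Measure.pi (axialLaw P k)))) :
    IsDC terms Λ qU (fun t => (D t).extMeasure (axialLaw P k))
      (fun t q v' ψ => X₀ t q v' ψ * (sX Λ qU D M t q v' : ℂ) * (normPrint Λ D ek T M E R c t ((D t).split q).1 v' : ℂ))
      (fun t q v' _ => (D t).fibreMeasure (lawInt Λ D ek T M E R r t ((D t).split q).1 v') ((D t).split q).1) B₀ ρL :=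
  eq5128_gauge (isDT_axial_iff.mp h) hek hr hT hK hMs hMpd hMm hc X₀ B₀ hv hX₀ hJ haOut hidem hBm hBretr hBwin hch hJi

/-- **Instance: the locality `hv` BY NAME** for r18's block average `qU` under the nesting condition of p. 300 (`BIJ88Eq5128Locality.vCut_freeze_eq_qU`:
every coarse bond outside the cut-off `Λ_t` has its `qU`-support outside `Λ^{c*c}_{10}`), measure `𝒟u δ_{Ax}`. [cite: BalabanImbrieJaffe1988, (5.12.8) p.303] -/
theorem eq5128_gauge_axial_qU {terms : Finset ι}
    {J : ι → Prev P k → GaugeField P k U1 → GaugeField P (k+1) U1 → HiggsField P k → HiggsField P (k+1) → ℂ}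
    {ρL : GaugeField P (k+1) U1 → HiggsField P (k+1) → ℂ} {c : ι → ℝ}
    (h : IsDT (BIJ88RenormTransf311.axialMeasure P k U1) terms Λ qU J ρL)
    (hek : 0 < ek) (hr : ek * r < π) (hT : ∀ t, (T t).IsSymm) (hK : ∀ t, (precK (inIb (D t)) (T t) (E t)).PosDef)
    (hMs : ∀ t v, (M t v).IsSymm) (hMpd : ∀ t v, (blkIn (inIx (D t)) (M t v)).PosDef) (hMm : ∀ t i j, Measurable fun v => M t v i j)
    (hc : ∀ t, 0 ≤ c t)
    (X₀ B₀ : ι → Cfg P k → GaugeField P (k+1) U1 → HiggsField P (k+1) → ℂ)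
    (hIb : ∀ t ∈ terms, ∀ c', c' ∉ Λ t → ∀ b ∈ BIJ88Eq5128Locality.qUSupport c', b ∉ (D t).Ib)
    (hX₀ : ∀ t ∈ terms, ∀ q v' ψ, X₀ t ((D t).freeze q) v' ψ = X₀ t q v' ψ)
    (hJ : ∀ t ∈ terms, ∀ q v' ψ, readEntry Λ qU J t q v' ψ =
      X₀ t q v' ψ * (gW Λ D ek T t q : ℂ) *
        (Real.exp (-(1 / 2 : ℝ) * (realCoords q.2.2 ⬝ᵥ (M t (vCut qU (Λ t) q.1 v') *ᵥ realCoords q.2.2))) : ℂ) * B₀ t q v' ψ)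
    (haOut : ∀ t ∈ terms, ∀ (e : (D t).Ext) (i : (D t).Int), aOut Λ D ek t ((D t).glue e i) = aOut Λ D ek t ((D t).glue e (D t).base))
    (hidem : ∀ t ∈ terms, ∀ (e : (D t).Ext) (i₁ : (D t).IU), yInt Λ D t e (yInt Λ D t e i₁) = yInt Λ D t e i₁)
    (hBm : ∀ t v' ψ, Measurable fun q => B₀ t q v' ψ)
    (hBretr : ∀ t ∈ terms, ∀ (e : (D t).Ext) (i : (D t).Int) v' ψ, B₀ t ((D t).glue e i) v' ψ = B₀ t ((D t).glue e (retr Λ D t e i)) v' ψ)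
    (hBwin : ∀ t ∈ terms, ∀ q v' ψ, B₀ t q v' ψ ≠ 0 → ∀ b, |aIn Λ D ek t q b| ≤ r)
    (hch : ∀ t ∈ terms, ∀ e : (D t).Ext, HChart Λ D ek E R c r (axialLaw P k) t e)
    (hJi : ∀ t ∈ terms, Integrable (termIntegrand Λ qU J t) (termMeasure (Measure.pi (axialLaw P k)))) :
    IsDC terms Λ qU (fun t => (D t).extMeasure (axialLaw P k))
      (fun t q v' ψ => X₀ t q v' ψ * (sX Λ qU D M t q v' : ℂ) * (normPrint Λ D ek T M E R c t ((D t).split q).1 v' : ℂ))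
      (fun t q v' _ => (D t).fibreMeasure (lawInt Λ D ek T M E R r t ((D t).split q).1 v') ((D t).split q).1) B₀ ρL :=
  eq5128_gauge_axial h hek hr hT hK hMs hMpd hMm hc X₀ B₀
    (fun t ht q v' => BIJ88Eq5128Locality.vCut_freeze_eq_qU (D t) (Λ t) (hIb t ht) q v') hX₀ hJ haOut hidem hBm hBretr hBwin hch hJi

end Main

end

end Literature.MathematicalPhysics.QuantumFieldTheory.BalabanImbrieJaffe1984to88.BIJ88Eq5127GaugeSector
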